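import Literature.MathematicalPhysics.QuantumFieldTheory.Balaban1983to89.T4DatumAssemblyTower
import Literature.MathematicalPhysics.QuantumFieldTheory.Balaban1983to89.Node00.LargeFieldReprOfRecord
import Literature.MathematicalPhysics.QuantumFieldTheory.Balaban1983to89.B14NodeKnitRepTowerLF

/-!
# `Balaban1983to89.B14NodeKnitTowerDatum` — YM-DAG node N11 · [Balaban1988Convergent] CMP **119** (1988) 243–285, Theorem 1 p. 262
# (with the Theorem of p. 245 and the ASSUMED operation 𝐑 of p. 244): the N11 knit AT A TOWER DATUM `T4DatumAssembly.datumOfTower F N M τ`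
# — the Stage-₉ datum SHAPE of record (machine core + EXPLICIT density tower along the averaging of record) — over a represented tower,
# in the tree's §2 currency, and over the SLOT FAMILY of the (2.18) representation of record (`Node00.TexpAOfRecord`, `densityOfRepr`)

statement-level bookkeeping over published theorems with citation tags; kernel-checked compositions of tree theorems;
nothing here is a claim about the Yang–Mills mass gap.

CITATION HEADER (lean-in-tree rule).  Source: T. Bałaban, *Convergent renormalization expansions for lattice gauge theories*,
Commun. Math. Phys. **119**, 243–285 (1988), doi:10.1007/bf01217741 [Balaban1988Convergent] (cell paper B14 = «[III]»); the large-field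
representation (2.18) p. 257; the renormalization step (3.1) p. 264 and its rewriting (3.24)–(3.25) p. 270; the operation 𝐑 of
[Balaban1989LargeFieldI] (0.3) p. 176, ASSUMED in [III] p. 244.  Seat `pub-ymgap-dag-n11-a` (YM-PLAN Track A, HUMAN RULING D-0062: the
KNIT-BY-NAME seat of node N11; chair R420 ∕ R422 ∕ R424 ∕ R434 ∕ R437 ∕ R439).  BY NAME and UNCHANGED: `…T4DatumAssemblyTower` (seat dag-n23-a:
`RGMachineCore`, `RGMachineCore.Tower`, `RGMachineCore.construction`, `construction_sect2Form`, `datumOfTower`, `datumOfTower_C`,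
`RGMachineCore.rhoZero_eq_rhoZeroOfRecord`), `…Node00.LargeFieldReprOfRecord` (seat node00-def-R: `SeqOfRecord`, `chiSeqOfRecord`, `TexpAOfRecord`,
`densityOfRepr`, `rhoZeroOfRecord`), `…B14NodeKnitRepTower` (`b14_main_of_propTower`), `…B14NodeKnitRepTowerLF` (`b14_main_of_repTower_lf`),
the pre-cell module `…Step` (`LFTower`, `LFConsts`, `LFHyp`, `LFHypImproved`, `LFNewTerms`, `LFSigns`), `…Dag` (`B14_main` :224), `…DagBinding`
(`leavesP`, `WorldP`).

WHY THIS FILE (pub-ymgap chair R437 ∕ R439; seat node00-def `STAGE6-9-DESIGN-g28.md`; seat dag-n23-a `T4DatumAssemblyTower` + probe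
`Record9_via_Tower`; seats node00-def-T `READING-NOTE-T9.md` ∕ node00-def-R `RStepSlotOfRecord`; seat dag-n13-a probe `VOfTower`).  NODE 00's
Stage ₉ datum of record is to be `T4DatumAssembly.datumOfTower F N M τ` at the machine CORE of record `M` and the REPRESENTED density tower of
record `τ` — densities `τ.ρ p k := Node00.densityOfRepr … texpA p g k`, the density ASSEMBLED from the slot family `texpA p g k : s ↦ (𝐓_k e^{A_k})(s)`
of the (2.18) representation ([III] p. 257), the slot family built by recursion `texpA p g (k+1) = Rstep (Tstep (texpA p g k))` from the
value-level T-step (3.1)∕(3.24) and the R-step (0.3) [IV] acting ON SLOTS.  At a world bound to such a datum (`w.C = (datumOfTower F N M τ).C`)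
N11's conclusion `densitiesDescribed` IS the core's clause `∀ k ≤ K, M.Sect2Form P k` (`construction_sect2Form`, `rfl`), and under the Stage-₉
reading of that clause — `M.Sect2Form P k ↔ (τ.ρ P k = eval rep_k ∧ Laws rep_k)`, the (2.18) form WITH §2's conditions and bounds as laws of the
CARRIED representation (Thm 1 p. 262: «have the form, and satisfy all the conditions and bounds, described in Sect. 2») — N11 at `(w, P)` is LAW
PRESERVATION ALONG THE TOWER: (S0) the start representation obeys the laws; (S1ᵀ) THE THEOREM OF p. 245 at representation level ([III] §1 for
k = 0, §3 + Thm 2 for k ≥ 1: the T-step carries law-abiding representations into the corresponding space, p. 262), GIVEN the node's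
antecedents; (𝐑) the assumed property of 𝐑 (p. 244; node N13's product), GIVEN the `rOperation` leaf — and when NODE 00 pins the world's 𝐑-leaf
ALONG the run's tower (seat dag-n13-a's `VOfTower`: `ROpLeaf V ↔ ∀ k < K, LawsT k (Tstep rep_k) → Laws (k+1) rep_{k+1}`), (𝐑) is the leaf
itself and N11 needs EXACTLY (S0) + (S1ᵀ).  This file is that knit, stated against the LANDED assembler and representation modules only,
generic over the representation data (§1), in the tree's own §2 currency `Step.LFHyp ∕ LFHypImproved ∕ LFNewTerms` (§1), and over the SLOT
FAMILY of record with `eval := densityOfRepr` (§2) — so that NODE 00's `Record9` instantiates it by `rfl` (`hC := datumOfTower_C`-shaped,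
`hρ := rfl`, `hS9 := Iff.rfl`, `hsucc :=` node00-def-T's `texpAOfRecord_succ`), whatever its final field names.

WHAT THIS FILE PROVES (0 `sorry`, 0 `def`, standard axioms).
§1 `sect2Form_eq_core` ∕ `densitiesDescribed_iff_core` (at a tower-datum world the §2-form clause IS the core's); `b14_main_at_datumOfTower_of_propTower`
   (N11 from two ℕ-indexed space predicates read into the core's clause); `core_sect2Form_iff_laws` ∕ `densitiesDescribed_iff_laws_at_datumOfTower`
   (under the Stage-₉ reading N11's conclusion IS `∀ k ≤ K, Laws k (rep k)` — the vacuity audit A4 in kernel form: not closable by a trivially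
   true format unless `Laws` is trivial); **`b14_main_at_datumOfTower_repTower`** (slots (S0), (S1ᵀ), (𝐑) with `Rstep` named);
   **`b14_main_at_datumOfTower_along`** ((𝐑) read ALONG the tower — the form the pinned 𝐑-leaf delivers: N11 = (S0) + (S1ᵀ)); `laws_of_b14_main_at_datumOfTower`
   (converse); **`b14_main_at_datumOfTower_lf`** (the same in the tree's §2 currency, T-half with PRE-𝐑 obligations `NewT` and 𝐑-half SEPARATED).
§2 **`b14_main_at_datumOfTower_slots`** ∕ `…_slots_along` (the knit over the SLOT FAMILY `texpA P g` of the (2.18) representation of record with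
   `τ.ρ P k = densityOfRepr … texpA P g k`: slots in slot currency — (S0) `Laws 0 (texpA P g 0)`, (S1ᵀ) `Laws k (texpA P g k) → LawsT k (Tstep k (texpA P g k))`,
   (𝐑) `LawsT k f → Laws (k+1) (Rstep k f)`); `densitiesDescribed_iff_laws_slots`.
§3 `b14_main_forall_towerDatum` (the `S_N11 Rec₉` shape: N11 at every run of every world of a class bound to SOME tower datum carrying the slots).

HONEST FRAMING.  A count-neutral SLOT landing (R429 (4)(i)): N11 is NOT discharged; (S1ᵀ) = Sects. 1–3 + Thm 2 of [Balaban1988Convergent] at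
representation level is a displayed hypothesis (its T-step `Tstep` and laws `Laws`∕`LawsT` are NODE 00 Stage ₉'s: node00-def-T's `tstepOfRecord`,
the (3.10)–(3.25) representation law of its value); (𝐑) is the printed ASSUMPTION of p. 244 (discharged by [Balaban1989LargeFieldII], node N13);
the machine core, the tower, the representation data and the laws are parameters.  One finite four-torus programme at fixed `ε`, Bałaban AS
PRINTED with locators; nothing continuum ∕ ℝ⁴ ∕ OS ∕ mass gap ∕ Clay.
-/

noncomputable section

open MeasureTheory
open scoped BigOperators

namespace Literature.MathematicalPhysics.QuantumFieldTheory.Balaban1983to89.B14NodeKnitTowerDatum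

open DagBinding T4DatumAssembly T4Continuum Node00 Step
open B14NodeKnitRepTower (b14_main_of_propTower)
open B14NodeKnitRepTowerLF (b14_main_of_repTower_lf)

variable (F : T4Family) (N : ℕ) [NeZero N]

/-! ## §1. N11 at a tower datum `datumOfTower F N M τ` over a represented tower -/

section TowerDatum

variable (M : RGMachineCore F (SU N)) (τ : M.Tower (avOfRecord F N)) (w : WorldP) (P : B12.RunParams)

/-- At a world bound to the tower datum (`w.C = (datumOfTower F N M τ).C = M.construction τ.ρ`) the run's §2-form clause IS the machine core's
clause `M.Sect2Form P k` (`T4DatumAssembly.RGMachineCore.construction_sect2Form`, `rfl`). [cite: Balaban1988Convergent, Thm 1 p.262 (bookkeeping)] -/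
theorem sect2Form_eq_core (hC : w.C = (datumOfTower F N M τ).C) (k : ℕ) : (w.C P).Sect2Form k = M.Sect2Form P k := by
  rw [hC]
  rfl

/-- … so N11's conclusion `densitiesDescribed` at `(w, P)` IS `∀ k ≤ K, M.Sect2Form P k`. [cite: Balaban1988Convergent, Thm 1 p.262 (bookkeeping)] -/
theorem densitiesDescribed_iff_core (hC : w.C = (datumOfTower F N M τ).C) :
    (leavesP w P).densitiesDescribed ↔ ∀ k, k ≤ P.K → M.Sect2Form P k := by
  show (∀ k, k ≤ P.K → (w.C P).Sect2Form k) ↔ _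
  exact forall₂_congr fun k _ => by rw [sect2Form_eq_core F N M τ w P hC k]

/-- **N11 AT A TOWER DATUM from two ℕ-indexed space predicates** ([Balaban1988Convergent] Thm 1 p. 262, the induction verbatim): `InS k` «the
`k`-th carried object lies in the index-`k` space», `InT k` «its renormalization transform lies in the corresponding space», READ into the CORE's
clause (`hS`); slots (S0) start, (S1ᵀ) T-step (the Theorem of p. 245) GIVEN the node's antecedents, (𝐑) the assumed property of 𝐑 (p. 244)
GIVEN the `rOperation` leaf.  `B14NodeKnitRepTower.b14_main_of_propTower` at the core's clause. [cite: Balaban1988Convergent, Thm 1 p.262; Theorem p.245; p.244] -/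
theorem b14_main_at_datumOfTower_of_propTower (hC : w.C = (datumOfTower F N M τ).C) (InS InT : ℕ → Prop)
    (hS : ∀ k, k ≤ P.K → InS k → M.Sect2Form P k)
    (h0 : (leavesP w P).smallCouplings → InS 0)
    (hT : (leavesP w P).b7 → (leavesP w P).b8 → (leavesP w P).b9 → (leavesP w P).b10 → (leavesP w P).b11 →
      (leavesP w P).smallCouplings → (leavesP w P).smallFieldInductive → (leavesP w P).flowControl →
        ∀ k, k < P.K → InS k → InT k)
    (hR : (leavesP w P).rOperation → ∀ k, k < P.K → InT k → InS (k + 1)) :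
    Dag.B14_main (leavesP w P) :=
  b14_main_of_propTower w P InS InT (fun k hk h => (sect2Form_eq_core F N M τ w P hC k).mpr (hS k hk h)) h0 hT hR

variable {Rep : ℕ → Type*} (rep : (k : ℕ) → Rep k) (Tstep : (k : ℕ) → Rep k → Rep (k + 1))
  (Rstep : (k : ℕ) → Rep (k + 1) → Rep (k + 1)) (Laws : (k : ℕ) → Rep k → Prop) (LawsT : (k : ℕ) → Rep (k + 1) → Prop)
  (eval : (k : ℕ) → Rep k → Density (F.P P.K) k (SU N))

/-- **Under the Stage-₉ reading of the core's clause** — `M.Sect2Form P k ↔ (τ.ρ P k = eval rep_k ∧ Laws rep_k)` (`hS9`: the (2.18) form WITH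
§2's conditions and bounds as laws of the carried representation; seat dag-n13-a's `VOfTower` field `S`) with the tower's densities DEFINED as
`τ.ρ P k = eval rep_k` (`hρ`) — the clause IS the law of the carried representation. [cite: Balaban1988Convergent, (2.18) p.257 and Thm 1 p.262 (bookkeeping)] -/
theorem core_sect2Form_iff_laws (hρ : ∀ k, τ.ρ P k = eval k (rep k))
    (hS9 : ∀ k, k ≤ P.K → (M.Sect2Form P k ↔ (τ.ρ P k = eval k (rep k) ∧ Laws k (rep k)))) (k : ℕ) (hk : k ≤ P.K) :
    M.Sect2Form P k ↔ Laws k (rep k) := by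
  rw [hS9 k hk]
  exact ⟨fun h => h.2, fun h => ⟨hρ k, h⟩⟩

/-- … so N11's CONCLUSION at a tower-datum world under the Stage-₉ reading IS «every carried representation obeys the laws», `∀ k ≤ K,
Laws k (rep k)` — the vacuity audit A4 for N11 at Stage ₉ in kernel form (not closable by a trivially true format unless `Laws` itself is
trivial). [cite: Balaban1988Convergent, Thm 1 p.262 (bookkeeping)] -/
theorem densitiesDescribed_iff_laws_at_datumOfTower (hC : w.C = (datumOfTower F N M τ).C) (hρ : ∀ k, τ.ρ P k = eval k (rep k))
    (hS9 : ∀ k, k ≤ P.K → (M.Sect2Form P k ↔ (τ.ρ P k = eval k (rep k) ∧ Laws k (rep k)))) :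
    (leavesP w P).densitiesDescribed ↔ ∀ k, k ≤ P.K → Laws k (rep k) := by
  rw [densitiesDescribed_iff_core F N M τ w P hC]
  exact forall₂_congr fun k hk => core_sect2Form_iff_laws F N M τ P rep Laws eval hρ hS9 k hk

/-- **N11 AT A TOWER DATUM OVER A REPRESENTED TOWER** ([Balaban1988Convergent] Thm 1 p. 262 with the Theorem of p. 245 and the assumed 𝐑 of p. 244;
NODE 00 Stage ₉ shape, pub-ymgap chair R437): representation data `rep k : Rep k` per level with `rep (k+1) = Rstep k (Tstep k (rep k))` (`hsucc` —
[III] (0.2) `ρ_{k+1} = 𝐑𝐓ρ_k` at representation level; node00-def-T's `texpAOfRecord_succ`), the tower's densities `τ.ρ P k = eval rep_k` (`hρ`), the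
core's clause read as «form ∧ laws» (`hS9`).  N11 at `(w, P)` from: (S0) `h0` the start representation obeys the laws, under the interval hypothesis;
(S1ᵀ) `hT` THE THEOREM OF p. 245 AT REPRESENTATION LEVEL — GIVEN the in-edges `b7 … b11`, the interval hypothesis, the small-field inductive
assumptions and the flow control (2.6), `Tstep` carries law-abiding representations into the corresponding space, `k < K` ([III] §1 for k = 0,
§3 + Thm 2 for k ≥ 1); (𝐑) `hR` — GIVEN the `rOperation` leaf — `Rstep` carries the corresponding space into the index-`(k+1)` laws ([III]
p. 244; [Balaban1989LargeFieldII]). [cite: Balaban1988Convergent, Thm 1 p.262; Theorem p.245; (0.2) and p.244] -/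
theorem b14_main_at_datumOfTower_repTower (hC : w.C = (datumOfTower F N M τ).C)
    (hsucc : ∀ k, rep (k + 1) = Rstep k (Tstep k (rep k)))
    (hρ : ∀ k, τ.ρ P k = eval k (rep k))
    (hS9 : ∀ k, k ≤ P.K → (M.Sect2Form P k ↔ (τ.ρ P k = eval k (rep k) ∧ Laws k (rep k))))
    (h0 : (leavesP w P).smallCouplings → Laws 0 (rep 0))
    (hT : (leavesP w P).b7 → (leavesP w P).b8 → (leavesP w P).b9 → (leavesP w P).b10 → (leavesP w P).b11 →
      (leavesP w P).smallCouplings → (leavesP w P).smallFieldInductive → (leavesP w P).flowControl →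
        ∀ k, k < P.K → Laws k (rep k) → LawsT k (Tstep k (rep k)))
    (hR : (leavesP w P).rOperation → ∀ k, k < P.K → ∀ r : Rep (k + 1), LawsT k r → Laws (k + 1) (Rstep k r)) :
    Dag.B14_main (leavesP w P) :=
  b14_main_at_datumOfTower_of_propTower F N M τ w P hC (fun k => Laws k (rep k)) (fun k => LawsT k (Tstep k (rep k)))
    (fun k hk h => (core_sect2Form_iff_laws F N M τ P rep Laws eval hρ hS9 k hk).2 h) h0 hT
    (fun hrop k hk h => by rw [hsucc]; exact hR hrop k hk _ h)

/-- **N11 AT A TOWER DATUM, (𝐑) READ ALONG THE TOWER** (`LawsT k (Tstep k (rep k)) → Laws (k+1) (rep (k+1))`, no `Rstep` named) — the form NODE 00's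
𝐑-leaf PINNED ALONG THE RUN'S TOWER delivers by `Iff.rfl` (seat dag-n13-a's `VOfTower`: `ROpLeaf V ↔ ∀ k < K, LawsT k (rT k) → Laws (k+1) (rep (k+1))`);
at such a world N11 at `(w, P)` needs EXACTLY (S0) `h0` and (S1ᵀ) `hT`. [cite: Balaban1988Convergent, Thm 1 p.262; Theorem p.245; p.244] -/
theorem b14_main_at_datumOfTower_along (hC : w.C = (datumOfTower F N M τ).C) (hρ : ∀ k, τ.ρ P k = eval k (rep k))
    (hS9 : ∀ k, k ≤ P.K → (M.Sect2Form P k ↔ (τ.ρ P k = eval k (rep k) ∧ Laws k (rep k))))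
    (h0 : (leavesP w P).smallCouplings → Laws 0 (rep 0))
    (hT : (leavesP w P).b7 → (leavesP w P).b8 → (leavesP w P).b9 → (leavesP w P).b10 → (leavesP w P).b11 →
      (leavesP w P).smallCouplings → (leavesP w P).smallFieldInductive → (leavesP w P).flowControl →
        ∀ k, k < P.K → Laws k (rep k) → LawsT k (Tstep k (rep k)))
    (hR : (leavesP w P).rOperation → ∀ k, k < P.K → LawsT k (Tstep k (rep k)) → Laws (k + 1) (rep (k + 1))) :
    Dag.B14_main (leavesP w P) :=
  b14_main_at_datumOfTower_of_propTower F N M τ w P hC (fun k => Laws k (rep k)) (fun k => LawsT k (Tstep k (rep k)))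
    (fun k hk h => (core_sect2Form_iff_laws F N M τ P rep Laws eval hρ hS9 k hk).2 h) h0 hT hR

/-- Conversely, under the Stage-₉ reading N11 at a tower-datum world YIELDS the laws along the tower whenever its antecedents hold: the node's content
there is exactly law preservation (located, for the planner's `stub_N11` text over Stage ₉). [cite: Balaban1988Convergent, Thm 1 p.262 (bookkeeping)] -/
theorem laws_of_b14_main_at_datumOfTower (hC : w.C = (datumOfTower F N M τ).C) (hρ : ∀ k, τ.ρ P k = eval k (rep k))
    (hS9 : ∀ k, k ≤ P.K → (M.Sect2Form P k ↔ (τ.ρ P k = eval k (rep k) ∧ Laws k (rep k))))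
    (h : Dag.B14_main (leavesP w P))
    (h7 : (leavesP w P).b7) (h8 : (leavesP w P).b8) (h9 : (leavesP w P).b9) (h10 : (leavesP w P).b10) (h11 : (leavesP w P).b11)
    (hsf : (leavesP w P).smallCouplings → (leavesP w P).smallFieldInductive)
    (hfc : (leavesP w P).smallCouplings → (leavesP w P).flowControl)
    (hrop : (leavesP w P).rOperation) (hsc : (leavesP w P).smallCouplings) :
    ∀ k, k ≤ P.K → Laws k (rep k) :=
  (densitiesDescribed_iff_laws_at_datumOfTower F N M τ w P rep Laws eval hC hρ hS9).1 (h h7 h8 h9 h10 h11 hsf hfc hrop hsc)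

variable {G : Type*} [GaugeGroup G] {Φ 𝒢 𝔄 : Type*} {Pₛ : Params} (T : LFTower Pₛ G Φ 𝒢 𝔄) (c : LFConsts) (βc : ℝ)

/-- **N11 AT A TOWER DATUM IN THE TREE'S §2 CURRENCY, T-HALF AND 𝐑-HALF SEPARATED** ([Balaban1988Convergent] Thm 1 p. 262 with the Theorem of p. 245
and the assumed 𝐑 of p. 244): the core's clause read as `τ.ρ P k = eval rep_k ∧ (Repr k ∧ Step.LFHyp T c k ∧ Step.LFHypImproved T c βc k)` — the
(2.18) form, the cumulative conditions and BOUNDS of §2 ((0.20), (2.27), (2.31), (2.42): `boundE ∕ boundR ∕ boundB`) and the improved newest-term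
bounds, verbatim «form, conditions and bounds» —; slots: the signs under the interval hypothesis (`hsg`), (S0) `Repr 0` (no terms at index 0),
(S1ᵀ) THE THEOREM OF p. 245 delivering the T-representation and the PRE-𝐑 new-term obligations `NewT k` (p. 279), (𝐑) delivering `Repr (k+1) ∧
Step.LFNewTerms T c βc k` (p. 244); the bounds' index shift is the tree's bookkeeping (`B14NodeKnitRepTowerLF.laws_succ_of_newTerms`).
`B14NodeKnitRepTowerLF.b14_main_of_repTower_lf` at the core's clause. [cite: Balaban1988Convergent, Thm 1 p.262; Theorem p.245; p.279; pp.258–262; p.244] -/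
theorem b14_main_at_datumOfTower_lf (hC : w.C = (datumOfTower F N M τ).C) (Repr ReprT NewT : ℕ → Prop)
    (hρ : ∀ k, τ.ρ P k = eval k (rep k))
    (hS9 : ∀ k, k ≤ P.K →
      (M.Sect2Form P k ↔ (τ.ρ P k = eval k (rep k) ∧ (Repr k ∧ LFHyp T c k ∧ LFHypImproved T c βc k))))
    (hsg : (leavesP w P).smallCouplings → LFSigns T c βc P.K)
    (h0 : (leavesP w P).smallCouplings → Repr 0)
    (hT : (leavesP w P).b7 → (leavesP w P).b8 → (leavesP w P).b9 → (leavesP w P).b10 → (leavesP w P).b11 →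
      (leavesP w P).smallCouplings → (leavesP w P).smallFieldInductive → (leavesP w P).flowControl →
        ∀ k, k < P.K → Repr k → LFHyp T c k → LFHypImproved T c βc k → ReprT k ∧ NewT k)
    (hR : (leavesP w P).rOperation → ∀ k, k < P.K → ReprT k → NewT k → Repr (k + 1) ∧ LFNewTerms T c βc k) :
    Dag.B14_main (leavesP w P) :=
  b14_main_of_repTower_lf w P T c βc Repr ReprT NewT
    (fun k hk hr h1 h2 => (sect2Form_eq_core F N M τ w P hC k).mpr ((hS9 k hk).2 ⟨hρ k, hr, h1, h2⟩)) hsg h0 hT hR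

end TowerDatum

/-! ## §2. N11 at a tower datum over the SLOT FAMILY of the (2.18) representation of record (`eval := Node00.densityOfRepr`) -/

section Slots

variable (M : RGMachineCore F (SU N)) (τ : M.Tower (avOfRecord F N)) (w : WorldP) (P : B12.RunParams)
variable (ν : Stage7Numerics) (Mx : ℕ) (g : ℕ → ℝ) (texpA : TexpAOfRecord F N ν Mx)
variable
  (Tstep : (k : ℕ) → (SeqOfRecord F ν Mx g P.K k → Density (F.P P.K) k (SU N)) →
    (SeqOfRecord F ν Mx g P.K (k + 1) → Density (F.P P.K) (k + 1) (SU N)))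
  (Rstep : (k : ℕ) → (SeqOfRecord F ν Mx g P.K (k + 1) → Density (F.P P.K) (k + 1) (SU N)) →
    (SeqOfRecord F ν Mx g P.K (k + 1) → Density (F.P P.K) (k + 1) (SU N)))
  (Laws : (k : ℕ) → (SeqOfRecord F ν Mx g P.K k → Density (F.P P.K) k (SU N)) → Prop)
  (LawsT : (k : ℕ) → (SeqOfRecord F ν Mx g P.K (k + 1) → Density (F.P P.K) (k + 1) (SU N)) → Prop)

/-- The density assembled from a slot family at level `k` is the SLICE density `V ↦ Σ_s χ_k(s)(V)·f(s)(V)` of its level-`k` slot `f = texpA P g k`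
(`rfl`; node00-def-R's `densityOfSlice`). [cite: Balaban1988Convergent, (2.18) p.257 (bookkeeping)] -/
theorem densityOfRepr_eq_slice (k : ℕ) :
    densityOfRepr F N ν Mx texpA P g k =
      (fun (j : ℕ) (f : SeqOfRecord F ν Mx g P.K j → Density (F.P P.K) j (SU N)) (V : GaugeField (F.P P.K) j (SU N)) =>
        ∑ s, chiSeqOfRecord F N ν Mx g P.K j s V * f s V) k (texpA P g k) := rfl

/-- **N11 AT A TOWER DATUM OVER THE SLOT FAMILY OF RECORD** ([Balaban1988Convergent] Thm 1 p. 262 with the Theorem of p. 245 and the assumed 𝐑 of p. 244;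
NODE 00 Stage ₉: node00-def-R FILE 4 + node00-def-T's slot recursion): the run's representation data ARE its slots `texpA P g k : s ↦ (𝐓_k e^{A_k})(s)`
((2.18) p. 257), built by `texpA P g (k+1) = Rstep k (Tstep k (texpA P g k))` (`hsucc`: the value-level T-step (3.1)∕(3.24) p. 264∕270 then the R-step
[IV] (0.3) ON SLOTS; node00-def-T's `texpAOfRecord_succ`, `rfl`), the tower's densities are the assembled ones `τ.ρ P k = densityOfRepr … texpA P g k`
(`hρ`; NODE 00's `Record9`, `rfl`), the core's clause reads «assembled ∧ laws of the slot» (`hS9`).  N11 at `(w, P)` from the three slots IN SLOT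
CURRENCY: (S0) `h0` the level-0 slot (every length-0 sequence carries `ρ₀`, `χ_0 ≡ 1`) obeys `Laws 0`; (S1ᵀ) `hT` THE THEOREM OF p. 245: a
law-abiding level-`k` slot has a T-step obeying `LawsT k` (its (3.25) representation with the pre-𝐑 new terms of p. 279 in their spaces), GIVEN the
node's antecedents; (𝐑) `hR` the assumed 𝐑 of p. 244 GIVEN the leaf. [cite: Balaban1988Convergent, Thm 1 p.262; Theorem p.245; (2.18) p.257; (3.24)–(3.25) p.270; p.244] -/
theorem b14_main_at_datumOfTower_slots (hC : w.C = (datumOfTower F N M τ).C)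
    (hsucc : ∀ k, texpA P g (k + 1) = Rstep k (Tstep k (texpA P g k)))
    (hρ : ∀ k, τ.ρ P k = densityOfRepr F N ν Mx texpA P g k)
    (hS9 : ∀ k, k ≤ P.K → (M.Sect2Form P k ↔ (τ.ρ P k = densityOfRepr F N ν Mx texpA P g k ∧ Laws k (texpA P g k))))
    (h0 : (leavesP w P).smallCouplings → Laws 0 (texpA P g 0))
    (hT : (leavesP w P).b7 → (leavesP w P).b8 → (leavesP w P).b9 → (leavesP w P).b10 → (leavesP w P).b11 →
      (leavesP w P).smallCouplings → (leavesP w P).smallFieldInductive → (leavesP w P).flowControl →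
        ∀ k, k < P.K → Laws k (texpA P g k) → LawsT k (Tstep k (texpA P g k)))
    (hR : (leavesP w P).rOperation → ∀ k, k < P.K →
      ∀ f : SeqOfRecord F ν Mx g P.K (k + 1) → Density (F.P P.K) (k + 1) (SU N), LawsT k f → Laws (k + 1) (Rstep k f)) :
    Dag.B14_main (leavesP w P) :=
  b14_main_at_datumOfTower_repTower F N M τ w P (Rep := fun k => SeqOfRecord F ν Mx g P.K k → Density (F.P P.K) k (SU N))
    (texpA P g) Tstep Rstep Laws LawsT
    (fun (j : ℕ) (f : SeqOfRecord F ν Mx g P.K j → Density (F.P P.K) j (SU N)) (V : GaugeField (F.P P.K) j (SU N)) =>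
      ∑ s, chiSeqOfRecord F N ν Mx g P.K j s V * f s V)
    hC hsucc hρ hS9 h0 hT hR

/-- The same with (𝐑) read ALONG the slot family (`LawsT k (Tstep k (texpA P g k)) → Laws (k+1) (texpA P g (k+1))`) — the form the 𝐑-leaf pinned
along the run's tower delivers; N11 = (S0) + (S1ᵀ) there. [cite: Balaban1988Convergent, Thm 1 p.262; Theorem p.245; p.244] -/
theorem b14_main_at_datumOfTower_slots_along (hC : w.C = (datumOfTower F N M τ).C)
    (hρ : ∀ k, τ.ρ P k = densityOfRepr F N ν Mx texpA P g k)
    (hS9 : ∀ k, k ≤ P.K → (M.Sect2Form P k ↔ (τ.ρ P k = densityOfRepr F N ν Mx texpA P g k ∧ Laws k (texpA P g k))))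
    (h0 : (leavesP w P).smallCouplings → Laws 0 (texpA P g 0))
    (hT : (leavesP w P).b7 → (leavesP w P).b8 → (leavesP w P).b9 → (leavesP w P).b10 → (leavesP w P).b11 →
      (leavesP w P).smallCouplings → (leavesP w P).smallFieldInductive → (leavesP w P).flowControl →
        ∀ k, k < P.K → Laws k (texpA P g k) → LawsT k (Tstep k (texpA P g k)))
    (hR : (leavesP w P).rOperation → ∀ k, k < P.K → LawsT k (Tstep k (texpA P g k)) → Laws (k + 1) (texpA P g (k + 1))) :
    Dag.B14_main (leavesP w P) :=
  b14_main_at_datumOfTower_along F N M τ w P (Rep := fun k => SeqOfRecord F ν Mx g P.K k → Density (F.P P.K) k (SU N))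
    (texpA P g) Tstep Laws LawsT
    (fun (j : ℕ) (f : SeqOfRecord F ν Mx g P.K j → Density (F.P P.K) j (SU N)) (V : GaugeField (F.P P.K) j (SU N)) =>
      ∑ s, chiSeqOfRecord F N ν Mx g P.K j s V * f s V)
    hC hρ hS9 h0 hT hR

/-- Under the Stage-₉ reading over the slot family, N11's conclusion at `(w, P)` IS `∀ k ≤ K, Laws k (texpA P g k)` — every slot of the run obeys the
laws. [cite: Balaban1988Convergent, Thm 1 p.262 (bookkeeping)] -/
theorem densitiesDescribed_iff_laws_slots (hC : w.C = (datumOfTower F N M τ).C)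
    (hρ : ∀ k, τ.ρ P k = densityOfRepr F N ν Mx texpA P g k)
    (hS9 : ∀ k, k ≤ P.K → (M.Sect2Form P k ↔ (τ.ρ P k = densityOfRepr F N ν Mx texpA P g k ∧ Laws k (texpA P g k)))) :
    (leavesP w P).densitiesDescribed ↔ ∀ k, k ≤ P.K → Laws k (texpA P g k) :=
  densitiesDescribed_iff_laws_at_datumOfTower F N M τ w P (Rep := fun k => SeqOfRecord F ν Mx g P.K k → Density (F.P P.K) k (SU N))
    (texpA P g) Laws
    (fun (j : ℕ) (f : SeqOfRecord F ν Mx g P.K j → Density (F.P P.K) j (SU N)) (V : GaugeField (F.P P.K) j (SU N)) =>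
      ∑ s, chiSeqOfRecord F N ν Mx g P.K j s V * f s V)
    hC hρ hS9

end Slots

/-! ## §3. The `S_N11 Rec₉` shape: N11 at every run of every world bound to SOME tower datum carrying the slots -/

section RecShape

variable {F N}

/-- **`S_N11`-shaped over tower data** (R420 (C) ∕ R422: «every stub is typed over the PINNED carriers of record, or with an explicit `Rec` parameter»):
for ANY class `Rec` of binding worlds each bound to the tower datum of SOME core and tower and supplying, at every run, two space predicates with
the reading into the core's clause and the slots (S0), (S1ᵀ), (𝐑) of `b14_main_at_datumOfTower_of_propTower`, node N11 holds AT EVERY RUN OF EVERY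
`Rec`-WORLD.  At NODE 00's Stage-9 record `Rec w := ∃ D, IsRecordOfRecord₉C F N D w` the core and tower are the record's.
[cite: Balaban1988Convergent, Thm 1 p.262; Theorem p.245; p.244] -/
theorem b14_main_forall_towerDatum (Rec : WorldP → Prop)
    (h : ∀ w, Rec w → ∃ (M : RGMachineCore F (SU N)) (τ : M.Tower (avOfRecord F N)),
      w.C = (datumOfTower F N M τ).C ∧ ∀ P : B12.RunParams, ∃ InS InT : ℕ → Prop,
        (∀ k, k ≤ P.K → InS k → M.Sect2Form P k) ∧
        ((leavesP w P).smallCouplings → InS 0) ∧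
        ((leavesP w P).b7 → (leavesP w P).b8 → (leavesP w P).b9 → (leavesP w P).b10 → (leavesP w P).b11 →
          (leavesP w P).smallCouplings → (leavesP w P).smallFieldInductive → (leavesP w P).flowControl →
            ∀ k, k < P.K → InS k → InT k) ∧
        ((leavesP w P).rOperation → ∀ k, k < P.K → InT k → InS (k + 1))) :
    ∀ w, Rec w → ∀ P : B12.RunParams, Dag.B14_main (leavesP w P) := by
  intro w hw P
  obtain ⟨M, τ, hC, hP⟩ := h w hw
  obtain ⟨InS, InT, hS, h0, hT, hR⟩ := hP P
  exact b14_main_at_datumOfTower_of_propTower F N M τ w P hC InS InT hS h0 hT hR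

end RecShape

end Literature.MathematicalPhysics.QuantumFieldTheory.Balaban1983to89.B14NodeKnitTowerDatum

end
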